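import Mathlib.Topology.MetricSpace.Lipschitz
import Mathlib.Analysis.Convex.Function
import Literature.MathematicalPhysics.StatisticalMechanics.IsothermalEquationsOfState
import HarnessLib

/-!
# The static coexistence pressure of two phases from finitely many relaxations, I:
# Le Chatelier, concavity of the minimal enthalpy, the consistency test and the two-point bracket

Venture CertifiedManyBodySolver, cell `pub/hubbard-downfold` (S1 = downfolding front end = ROUTER),
seat hubbard-downfold-tool-2 (pressure runs / structural-transition flag);
namespace `Summit.Ventures.CertifiedManyBodySolver.Downfold.StructFlag`.

THE QUESTION. The P axis of the router (`tool/PRESSURE.md`, ROUTER §6 STRUCT-FLAG RULE, mod-2's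
`router/P-INTERVALS.md` §P.12(h)) needs, for two candidate structures of one material, the STATIC
COEXISTENCE PRESSURE `P*` at which their `T = 0` minimal enthalpies cross. A `vc-relax` run at a
target pressure `P` delivers, per phase `i`, ONE relaxed volume `Vᵢ(P)` minimising `V ↦ Eᵢ(V) + P V`
over the phase's volume set, and the minimal enthalpy `Hᵢ(P)` (`enthalpy`, lit-3's
`IsothermalEquationsOfState`). The files of record quote `P*` «by linear interpolation» of
`ΔH = H₂ - H₁` between two computed pressures — a SCREENING number. This file proves what the
MINIMUM PRINCIPLE ALONE certifies from such data (no equation of state, no convexity of `E(V)`, no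
differentiability):

* §1 ONE PHASE. The supporting line `H(P') ≤ H(P) + (P' - P)·V(P)` (`minEnthalpy_le_add_mul`),
  the two-sided increment `(q - p)·V(q) ≤ H(q) - H(p) ≤ (q - p)·V(p)` (`minEnthalpy_sub_mem_Icc`);
  LE CHATELIER: the equilibrium volume is non-increasing in `P` (`volume_le_of_lt`,
  `antitoneOn_volume`); `H` is CONCAVE in `P` (`concaveOn_minEnthalpy`) and LIPSCHITZ on a pressure
  interval with constant `max |V(a)| |V(b)|` (`lipschitzOnWith_minEnthalpy`,
  `continuousOn_minEnthalpy`) — the `T = 0` content of «`Ω = ∂G/∂P` at fixed `T`»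
  [cite: Kaxiras2003, App. C Table C.1] and of the concavity of the Gibbs function in `P`.
* §2 TWO PHASES. The increment sandwich for `ΔH` (`deltaH_sub_mem_Icc`):
  `(q - p)(V₂(q) - V₁(p)) ≤ ΔH(q) - ΔH(p) ≤ (q - p)(V₂(p) - V₁(q))`; the ENTHALPY–VOLUME
  CONSISTENCY TEST of a relax pair (`contrast_window_of_pair`):
  `d·(P_b - P_a) ≤ ΔH(P_a) - ΔH(P_b) ≤ D·(P_b - P_a)`, `D = V₁(P_a) - V₂(P_b)` the maximal and
  `d = V₁(P_b) - V₂(P_a)` the minimal volume contrast — necessary for four relaxed cells and two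
  enthalpy differences to be joint minima of two fixed `E(V)` curves; THE TWO-POINT COEXISTENCE
  BRACKET: `ΔH(P_a) = h_a > 0`, `ΔH(P_b) = -h_b < 0`, `ΔH(P*) = 0`, `P_a ≤ P* ≤ P_b` ⇒
  `P_a + h_a/D ≤ P* ≤ P_b - h_b/D` (`coexistence_mem_Icc_of_maxContrast`, assumption-free; `D > 0`
  follows) and, if `d > 0`, `P_b - h_b/d ≤ P* ≤ P_a + h_a/d` (`coexistence_mem_Icc_of_minContrast`);
  the finite-data form of the Maxwell common-tangent «critical pressure»
  [cite: Kaxiras2003, §5.6.1 (discussion of Fig. 5.6)]; lit-3's `commonTangent_transitionPressure`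
  is the case where the tangency volumes themselves are known.

Part II (`CoexistencePressureBracketRows`): uniqueness (`ΔH` strictly decreasing when `d > 0`) and
existence (intermediate value theorem) on a window, the contrast-band bracket (the screening
hypothesis behind «linear interpolation», made explicit) and the rows of record (FeSe #26 NM (8, 12) GPa,
LaH₁₀ (200, 250) GPa). Everything is PROVED; no named facts, no new definitions. WHAT THIS IS NOT:
a claim that any material transforms at a bracketed pressure — inputs are SCREENING-GRADE
static-DFT numbers (classical nuclei, one functional) entered as hypotheses; a passing consistency
test does not validate them, a failing one convicts the pair; the bracket concerns the STATIC
coexistence of the two candidate structures supplied, not a phase boundary of record (ROUTER §6: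
literature first).
-/

open Set

namespace Summit.Ventures.CertifiedManyBodySolver.Downfold.StructFlag

open Literature.MathematicalPhysics.StatisticalMechanics (enthalpy)

/-! ## §1 One phase: consequences of the minimum principle alone -/

/-- **Supporting line of the minimal enthalpy.** If `W'` minimises `V ↦ E(V) + P' V` over the
volume set `S` and `W ∈ S` is any admissible volume (in practice: the relaxed volume at another
pressure `P`), then `H(P') ≤ E(W) + P W + (P' - P) W`: the minimal enthalpy lies below each of its
«frozen-volume» lines (the `T = 0` Legendre-transform inequality behind `Ω = ∂G/∂P`, see the
module docstring). [folklore] -/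
theorem minEnthalpy_le_add_mul {E : ℝ → ℝ} {S : Set ℝ} {P P' W W' : ℝ}
    (hmin' : IsMinOn (enthalpy E P') S W') (hW : W ∈ S) :
    enthalpy E P' W' ≤ enthalpy E P W + (P' - P) * W := by
  have h : enthalpy E P' W' ≤ enthalpy E P' W := (isMinOn_iff.mp hmin') W hW
  have e : (P' - P) * W = P' * W - P * W := by ring
  unfold enthalpy at h ⊢
  linarith

/-- **Two-sided increment of the minimal enthalpy.** With relaxed volumes `Vp` at `p` and `Vq`
at `q` (each minimising its own enthalpy over the same volume set `S`),
`(q - p) Vq ≤ H(q) - H(p) ≤ (q - p) Vp`. [folklore] -/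
theorem minEnthalpy_sub_mem_Icc {E : ℝ → ℝ} {S : Set ℝ} {p q Vp Vq : ℝ}
    (hp : IsMinOn (enthalpy E p) S Vp) (hq : IsMinOn (enthalpy E q) S Vq)
    (hVp : Vp ∈ S) (hVq : Vq ∈ S) :
    enthalpy E q Vq - enthalpy E p Vp ∈ Icc ((q - p) * Vq) ((q - p) * Vp) := by
  have h1 := minEnthalpy_le_add_mul (P := q) hp hVq
  have h2 := minEnthalpy_le_add_mul (P := p) hq hVp
  have e1 : (p - q) * Vq = -((q - p) * Vq) := by ring
  constructor <;> linarith

/-- **Le Chatelier at `T = 0`: compression never increases the equilibrium volume.** If `Vp`, `Vq`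
are relaxed volumes of one phase at `p < q`, then `Vq ≤ Vp` — for ANY energy–volume curve (no
convexity, no equation of state). [folklore] -/
theorem volume_le_of_lt {E : ℝ → ℝ} {S : Set ℝ} {p q Vp Vq : ℝ}
    (hp : IsMinOn (enthalpy E p) S Vp) (hq : IsMinOn (enthalpy E q) S Vq)
    (hVp : Vp ∈ S) (hVq : Vq ∈ S) (hpq : p < q) : Vq ≤ Vp := by
  obtain ⟨h1, h2⟩ := minEnthalpy_sub_mem_Icc hp hq hVp hVq
  exact le_of_mul_le_mul_left (h1.trans h2) (sub_pos.mpr hpq)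

/-- **The equilibrium volume is a non-increasing function of pressure** along any family of
relaxations `v : P ↦ V(P)` of one phase on a pressure set `D`. [folklore] -/
theorem antitoneOn_volume {E : ℝ → ℝ} {S D : Set ℝ} {v : ℝ → ℝ}
    (hS : ∀ P ∈ D, v P ∈ S) (hmin : ∀ P ∈ D, IsMinOn (enthalpy E P) S (v P)) :
    AntitoneOn v D := by
  intro p hp q hq hpq
  rcases hpq.lt_or_eq with hlt | heq
  · exact volume_le_of_lt (hmin p hp) (hmin q hq) (hS p hp) (hS q hq) hlt
  · rw [heq]

/-- **The minimal enthalpy is concave in pressure** (on any convex pressure set carrying a family of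
relaxations): the `T = 0` case of the concavity of the Gibbs function in `P`. [folklore] -/
theorem concaveOn_minEnthalpy {E : ℝ → ℝ} {S D : Set ℝ} {v : ℝ → ℝ} (hD : Convex ℝ D)
    (hS : ∀ P ∈ D, v P ∈ S) (hmin : ∀ P ∈ D, IsMinOn (enthalpy E P) S (v P)) :
    ConcaveOn ℝ D (fun P => enthalpy E P (v P)) := by
  refine ⟨hD, ?_⟩
  intro x hx y hy a b ha hb hab
  have hz : a • x + b • y ∈ D := hD hx hy ha hb hab
  have h1 := minEnthalpy_le_add_mul (P := a • x + b • y) (hmin x hx) (hS _ hz)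
  have h2 := minEnthalpy_le_add_mul (P := a • x + b • y) (hmin y hy) (hS _ hz)
  simp only [smul_eq_mul] at h1 h2 hz ⊢
  have key : a * (x - (a * x + b * y)) + b * (y - (a * x + b * y)) = 0 := by
    linear_combination (-(a * x + b * y)) * hab
  calc a * enthalpy E x (v x) + b * enthalpy E y (v y)
      ≤ a * (enthalpy E (a * x + b * y) (v (a * x + b * y)) + (x - (a * x + b * y)) * v (a * x + b * y))
        + b * (enthalpy E (a * x + b * y) (v (a * x + b * y))
            + (y - (a * x + b * y)) * v (a * x + b * y)) :=
        add_le_add (mul_le_mul_of_nonneg_left h1 ha) (mul_le_mul_of_nonneg_left h2 hb)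
    _ = (a + b) * enthalpy E (a * x + b * y) (v (a * x + b * y))
        + (a * (x - (a * x + b * y)) + b * (y - (a * x + b * y))) * v (a * x + b * y) := by ring
    _ = enthalpy E (a * x + b * y) (v (a * x + b * y)) := by rw [hab, key]; ring

/-- **The minimal enthalpy is Lipschitz on a pressure interval**, with constant
`max |V(a)| |V(b)|` (the relaxed volumes in between lie between `V(b)` and `V(a)` by Le Chatelier).
[folklore] -/
theorem lipschitzOnWith_minEnthalpy {E : ℝ → ℝ} {S : Set ℝ} {v : ℝ → ℝ} {a b : ℝ}
    (hS : ∀ P ∈ Icc a b, v P ∈ S) (hmin : ∀ P ∈ Icc a b, IsMinOn (enthalpy E P) S (v P)) :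
    LipschitzOnWith (Real.toNNReal (max |v a| |v b|)) (fun P => enthalpy E P (v P)) (Icc a b) := by
  refine LipschitzOnWith.of_le_add_mul' _ fun x hx y hy => ?_
  have h := minEnthalpy_le_add_mul (P := y) (hmin x hx) (hS y hy)
  have hab : a ≤ b := hy.1.trans hy.2
  have hanti := antitoneOn_volume hS hmin
  have h1 : v b ≤ v y := hanti hy (right_mem_Icc.2 hab) hy.2
  have h2 : v y ≤ v a := hanti (left_mem_Icc.2 hab) hy hy.1
  have hv : |v y| ≤ max |v a| |v b| := by
    rw [max_comm]; exact abs_le_max_abs_abs h1 h2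
  have hxy : (x - y) * v y ≤ max |v a| |v b| * dist x y := by
    rw [Real.dist_eq]
    calc (x - y) * v y ≤ |(x - y) * v y| := le_abs_self _
      _ = |x - y| * |v y| := abs_mul _ _
      _ ≤ |x - y| * max |v a| |v b| := mul_le_mul_of_nonneg_left hv (abs_nonneg _)
      _ = max |v a| |v b| * |x - y| := mul_comm _ _
  show enthalpy E x (v x) ≤ enthalpy E y (v y) + max |v a| |v b| * dist x y
  linarith

/-- **The minimal enthalpy is continuous on a pressure interval** carrying relaxations at every
point. [folklore] -/
theorem continuousOn_minEnthalpy {E : ℝ → ℝ} {S : Set ℝ} {v : ℝ → ℝ} {a b : ℝ}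
    (hS : ∀ P ∈ Icc a b, v P ∈ S) (hmin : ∀ P ∈ Icc a b, IsMinOn (enthalpy E P) S (v P)) :
    ContinuousOn (fun P => enthalpy E P (v P)) (Icc a b) :=
  (lipschitzOnWith_minEnthalpy hS hmin).continuousOn

/-! ## §2 Two phases: the consistency test and the coexistence bracket

Phase 1 (energy curve `E₁`, volume set `S₁`, relaxed volumes `u…`) is the phase of LOWER enthalpy at
the lower pressure `P_a`; phase 2 (`E₂`, `S₂`, relaxed volumes `w…`) is the one of lower enthalpy at
the higher pressure `P_b`. `ΔH(P) = H₂(P) - H₁(P)`; `h_a = ΔH(P_a) > 0`, `h_b = -ΔH(P_b) > 0`. -/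

/-- **Increment sandwich for the enthalpy difference of two phases.** With relaxed volumes `u_p`,
`u_q` (phase 1) and `w_p`, `w_q` (phase 2) at pressures `p`, `q`:
`(q - p)(w_q - u_p) ≤ ΔH(q) - ΔH(p) ≤ (q - p)(w_p - u_q)`. [folklore] -/
theorem deltaH_sub_mem_Icc {E₁ E₂ : ℝ → ℝ} {S₁ S₂ : Set ℝ} {p q u_p u_q w_p w_q : ℝ}
    (h1p : IsMinOn (enthalpy E₁ p) S₁ u_p) (h1q : IsMinOn (enthalpy E₁ q) S₁ u_q)
    (h2p : IsMinOn (enthalpy E₂ p) S₂ w_p) (h2q : IsMinOn (enthalpy E₂ q) S₂ w_q)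
    (hu_p : u_p ∈ S₁) (hu_q : u_q ∈ S₁) (hw_p : w_p ∈ S₂) (hw_q : w_q ∈ S₂) :
    (enthalpy E₂ q w_q - enthalpy E₁ q u_q) - (enthalpy E₂ p w_p - enthalpy E₁ p u_p) ∈
      Icc ((q - p) * (w_q - u_p)) ((q - p) * (w_p - u_q)) := by
  obtain ⟨a1, b1⟩ := minEnthalpy_sub_mem_Icc h1p h1q hu_p hu_q
  obtain ⟨a2, b2⟩ := minEnthalpy_sub_mem_Icc h2p h2q hw_p hw_q
  have e1 : (q - p) * (w_q - u_p) = (q - p) * w_q - (q - p) * u_p := by ring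
  have e2 : (q - p) * (w_p - u_q) = (q - p) * w_p - (q - p) * u_q := by ring
  constructor <;> linarith

/-- **ENTHALPY–VOLUME CONSISTENCY TEST of a two-phase relax pair.** For relaxations of both phases
at `P_a ≤ P_b`, the drop of the enthalpy difference `ΔH(P_a) - ΔH(P_b)` lies between
`d·(P_b - P_a)` and `D·(P_b - P_a)`, where `D = u_a - w_b` is the MAXIMAL and `d = u_b - w_a` the
MINIMAL volume contrast of the four relaxed cells. A pair of `vc-relax` results violating either
inequality is not a pair of joint enthalpy minima of two fixed `E(V)` curves (a basin was missed, or
the cells are not converged). [folklore] -/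
theorem contrast_window_of_pair {E₁ E₂ : ℝ → ℝ} {S₁ S₂ : Set ℝ}
    {P_a P_b u_a u_b w_a w_b : ℝ}
    (h1a : IsMinOn (enthalpy E₁ P_a) S₁ u_a) (h1b : IsMinOn (enthalpy E₁ P_b) S₁ u_b)
    (h2a : IsMinOn (enthalpy E₂ P_a) S₂ w_a) (h2b : IsMinOn (enthalpy E₂ P_b) S₂ w_b)
    (hu_a : u_a ∈ S₁) (hu_b : u_b ∈ S₁) (hw_a : w_a ∈ S₂) (hw_b : w_b ∈ S₂) :
    (enthalpy E₂ P_a w_a - enthalpy E₁ P_a u_a) - (enthalpy E₂ P_b w_b - enthalpy E₁ P_b u_b) ∈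
      Icc ((u_b - w_a) * (P_b - P_a)) ((u_a - w_b) * (P_b - P_a)) := by
  obtain ⟨lo, hi⟩ := deltaH_sub_mem_Icc h1a h1b h2a h2b hu_a hu_b hw_a hw_b
  have e1 : (P_b - P_a) * (w_b - u_a) = -((u_a - w_b) * (P_b - P_a)) := by ring
  have e2 : (P_b - P_a) * (w_a - u_b) = -((u_b - w_a) * (P_b - P_a)) := by ring
  constructor <;> linarith

/-- **Lower bound on a coexistence pressure from a positive enthalpy difference (product form).**
If phase 1 is lower by `h_a = ΔH(P_a)` at `P_a`, and at some `P* ≥ P_a` phase 2 is not higher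
(`ΔH(P*) ≤ 0`), then `h_a ≤ (P* - P_a)(u_a - w_*)` with `u_a` phase 1's relaxed volume at `P_a`
and `w_*` phase 2's relaxed volume at `P*`. [folklore] -/
theorem deltaH_le_mul_contrast_left {E₁ E₂ : ℝ → ℝ} {S₁ S₂ : Set ℝ}
    {P_a P_s u_a u_s w_a w_s : ℝ}
    (h1a : IsMinOn (enthalpy E₁ P_a) S₁ u_a) (h1s : IsMinOn (enthalpy E₁ P_s) S₁ u_s)
    (h2a : IsMinOn (enthalpy E₂ P_a) S₂ w_a) (h2s : IsMinOn (enthalpy E₂ P_s) S₂ w_s)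
    (hu_a : u_a ∈ S₁) (hu_s : u_s ∈ S₁) (hw_a : w_a ∈ S₂) (hw_s : w_s ∈ S₂)
    (hs : enthalpy E₂ P_s w_s - enthalpy E₁ P_s u_s ≤ 0) :
    enthalpy E₂ P_a w_a - enthalpy E₁ P_a u_a ≤ (P_s - P_a) * (u_a - w_s) := by
  obtain ⟨lo, -⟩ := deltaH_sub_mem_Icc h1a h1s h2a h2s hu_a hu_s hw_a hw_s
  have e : (P_s - P_a) * (w_s - u_a) = -((P_s - P_a) * (u_a - w_s)) := by ring
  linarith

/-- **Upper bound on a coexistence pressure from a negative enthalpy difference (product form).**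
If phase 2 is lower by `h_b = -ΔH(P_b)` at `P_b`, and at some `P* ≤ P_b` phase 1 is not higher
(`0 ≤ ΔH(P*)`), then `h_b ≤ (P_b - P*)(u_* - w_b)`. [folklore] -/
theorem negDeltaH_le_mul_contrast_right {E₁ E₂ : ℝ → ℝ} {S₁ S₂ : Set ℝ}
    {P_s P_b u_s u_b w_s w_b : ℝ}
    (h1s : IsMinOn (enthalpy E₁ P_s) S₁ u_s) (h1b : IsMinOn (enthalpy E₁ P_b) S₁ u_b)
    (h2s : IsMinOn (enthalpy E₂ P_s) S₂ w_s) (h2b : IsMinOn (enthalpy E₂ P_b) S₂ w_b)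
    (hu_s : u_s ∈ S₁) (hu_b : u_b ∈ S₁) (hw_s : w_s ∈ S₂) (hw_b : w_b ∈ S₂)
    (hs : 0 ≤ enthalpy E₂ P_s w_s - enthalpy E₁ P_s u_s) :
    -(enthalpy E₂ P_b w_b - enthalpy E₁ P_b u_b) ≤ (P_b - P_s) * (u_s - w_b) := by
  obtain ⟨lo, -⟩ := deltaH_sub_mem_Icc h1s h1b h2s h2b hu_s hu_b hw_s hw_b
  have e : (P_b - P_s) * (w_b - u_s) = -((P_b - P_s) * (u_s - w_b)) := by ring
  linarith

/-- Two relaxed volumes of one phase at the SAME pressure have the same (minimal) enthalpy.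
[folklore] -/
theorem minEnthalpy_eq_of_isMinOn {E : ℝ → ℝ} {S : Set ℝ} {P W W' : ℝ}
    (h : IsMinOn (enthalpy E P) S W) (h' : IsMinOn (enthalpy E P) S W') (hW : W ∈ S)
    (hW' : W' ∈ S) : enthalpy E P W = enthalpy E P W' :=
  le_antisymm ((isMinOn_iff.mp h) W' hW') ((isMinOn_iff.mp h') W hW)

/-- Hence the enthalpy DIFFERENCE of two phases at one pressure does not depend on which relaxed
volumes are used to evaluate it. [folklore] -/
theorem deltaH_eq_of_isMinOn {E₁ E₂ : ℝ → ℝ} {S₁ S₂ : Set ℝ} {P u u' w w' : ℝ}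
    (h1 : IsMinOn (enthalpy E₁ P) S₁ u) (h1' : IsMinOn (enthalpy E₁ P) S₁ u')
    (h2 : IsMinOn (enthalpy E₂ P) S₂ w) (h2' : IsMinOn (enthalpy E₂ P) S₂ w')
    (hu : u ∈ S₁) (hu' : u' ∈ S₁) (hw : w ∈ S₂) (hw' : w' ∈ S₂) :
    enthalpy E₂ P w - enthalpy E₁ P u = enthalpy E₂ P w' - enthalpy E₁ P u' := by
  rw [minEnthalpy_eq_of_isMinOn h1 h1' hu hu', minEnthalpy_eq_of_isMinOn h2 h2' hw hw']

/-- Elementary division step: `0 < h`, `0 ≤ t`, `h ≤ t * c`, `c ≤ D` ⇒ `h / D ≤ t` (and `D > 0`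
is forced). [folklore] -/
theorem div_le_of_le_mul_of_le {h t c D : ℝ} (hh : 0 < h) (ht : 0 ≤ t) (hle : h ≤ t * c)
    (hcD : c ≤ D) : h / D ≤ t := by
  have hc : 0 < c := by
    by_contra hc
    have : t * c ≤ 0 := mul_nonpos_of_nonneg_of_nonpos ht (not_lt.mp hc)
    linarith
  have hD : 0 < D := hc.trans_le hcD
  rw [div_le_iff₀ hD]
  exact hle.trans (mul_le_mul_of_nonneg_left hcD ht)

/-- Elementary division step, the other direction: `0 < d ≤ c`, `t * c ≤ h` , `0 ≤ t` ⇒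
`t ≤ h / d`. [folklore] -/
theorem le_div_of_mul_le_of_le {h t c d : ℝ} (hd : 0 < d) (ht : 0 ≤ t) (hle : t * c ≤ h)
    (hdc : d ≤ c) : t ≤ h / d := by
  rw [le_div_iff₀ hd]
  exact (mul_le_mul_of_nonneg_left hdc ht).trans hle

/-- **THE TWO-POINT COEXISTENCE BRACKET, assumption-free form (maximal contrast).** Two phases
relaxed at `P_a ≤ P* ≤ P_b` (six relaxed volumes); phase 1 lower by `h_a > 0` at `P_a`, phase 2
lower by `h_b > 0` at `P_b`, equal minimal enthalpies at `P*`. Then with the MAXIMAL volume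
contrast `D = u_a - w_b` (phase 1 relaxed at the low end minus phase 2 relaxed at the high end;
`D > 0` follows and is not assumed): `P_a + h_a / D ≤ P* ≤ P_b - h_b / D` — the finite-data
form of the Maxwell common-tangent «critical pressure» (module docstring). [folklore] -/
theorem coexistence_mem_Icc_of_maxContrast {E₁ E₂ : ℝ → ℝ} {S₁ S₂ : Set ℝ}
    {P_a P_s P_b u_a u_s u_b w_a w_s w_b h_a h_b D : ℝ}
    (h1a : IsMinOn (enthalpy E₁ P_a) S₁ u_a) (h1s : IsMinOn (enthalpy E₁ P_s) S₁ u_s)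
    (h1b : IsMinOn (enthalpy E₁ P_b) S₁ u_b)
    (h2a : IsMinOn (enthalpy E₂ P_a) S₂ w_a) (h2s : IsMinOn (enthalpy E₂ P_s) S₂ w_s)
    (h2b : IsMinOn (enthalpy E₂ P_b) S₂ w_b)
    (hu_a : u_a ∈ S₁) (hu_s : u_s ∈ S₁) (hu_b : u_b ∈ S₁)
    (hw_a : w_a ∈ S₂) (hw_s : w_s ∈ S₂) (hw_b : w_b ∈ S₂)
    (has : P_a ≤ P_s) (hsb : P_s ≤ P_b)
    (hha : h_a = enthalpy E₂ P_a w_a - enthalpy E₁ P_a u_a) (ha_pos : 0 < h_a)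
    (hhb : h_b = enthalpy E₁ P_b u_b - enthalpy E₂ P_b w_b) (hb_pos : 0 < h_b)
    (hzero : enthalpy E₂ P_s w_s = enthalpy E₁ P_s u_s) (hD : D = u_a - w_b) :
    P_s ∈ Icc (P_a + h_a / D) (P_b - h_b / D) := by
  -- the coexistence pressure is strictly inside: at `P_a` / `P_b` the difference is not zero
  have hlt_a : P_a < P_s := lt_of_le_of_ne has fun h => by
    subst h
    have e := deltaH_eq_of_isMinOn h1a h1s h2a h2s hu_a hu_s hw_a hw_s
    rw [hzero, sub_self] at e
    linarith
  have hlt_b : P_s < P_b := lt_of_le_of_ne hsb fun h => by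
    subst h
    have e := deltaH_eq_of_isMinOn h1s h1b h2s h2b hu_s hu_b hw_s hw_b
    rw [hzero, sub_self] at e
    linarith
  -- Le Chatelier inside the window
  have hu : u_s ≤ u_a := volume_le_of_lt h1a h1s hu_a hu_s hlt_a
  have hw : w_b ≤ w_s := volume_le_of_lt h2s h2b hw_s hw_b hlt_b
  -- product forms at the two ends
  have hL := deltaH_le_mul_contrast_left h1a h1s h2a h2s hu_a hu_s hw_a hw_s (by rw [hzero, sub_self])
  have hR := negDeltaH_le_mul_contrast_right h1s h1b h2s h2b hu_s hu_b hw_s hw_b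
    (by rw [hzero, sub_self])
  rw [← hha] at hL
  have hR' : h_b ≤ (P_b - P_s) * (u_s - w_b) := by rw [hhb]; linarith
  have hDa : u_a - w_s ≤ D := by rw [hD]; linarith
  have hDb : u_s - w_b ≤ D := by rw [hD]; linarith
  have h1 := div_le_of_le_mul_of_le ha_pos (sub_nonneg.mpr has) hL hDa
  have h2 := div_le_of_le_mul_of_le hb_pos (sub_nonneg.mpr hsb) hR' hDb
  constructor <;> linarith

/-- **THE TWO-POINT COEXISTENCE BRACKET, minimal-contrast form.** Same data; if moreover the
MINIMAL volume contrast `d = u_b - w_a` (phase 1 relaxed at the HIGH end minus phase 2 relaxed at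
the LOW end) is positive — the dense phase at `P_a` is still denser than the light phase at `P_b` —
then also `P_b - h_b / d ≤ P* ≤ P_a + h_a / d`. Together with the maximal-contrast form this pins
`P*` from both sides of each end; for a pressure-independent contrast (`d = D`) the two brackets
collapse onto the linear-interpolation point. [folklore] -/
theorem coexistence_mem_Icc_of_minContrast {E₁ E₂ : ℝ → ℝ} {S₁ S₂ : Set ℝ}
    {P_a P_s P_b u_a u_s u_b w_a w_s w_b h_a h_b d : ℝ}
    (h1a : IsMinOn (enthalpy E₁ P_a) S₁ u_a) (h1s : IsMinOn (enthalpy E₁ P_s) S₁ u_s)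
    (h1b : IsMinOn (enthalpy E₁ P_b) S₁ u_b)
    (h2a : IsMinOn (enthalpy E₂ P_a) S₂ w_a) (h2s : IsMinOn (enthalpy E₂ P_s) S₂ w_s)
    (h2b : IsMinOn (enthalpy E₂ P_b) S₂ w_b)
    (hu_a : u_a ∈ S₁) (hu_s : u_s ∈ S₁) (hu_b : u_b ∈ S₁)
    (hw_a : w_a ∈ S₂) (hw_s : w_s ∈ S₂) (hw_b : w_b ∈ S₂)
    (has : P_a ≤ P_s) (hsb : P_s ≤ P_b)
    (hha : h_a = enthalpy E₂ P_a w_a - enthalpy E₁ P_a u_a) (ha_pos : 0 < h_a)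
    (hhb : h_b = enthalpy E₁ P_b u_b - enthalpy E₂ P_b w_b) (hb_pos : 0 < h_b)
    (hzero : enthalpy E₂ P_s w_s = enthalpy E₁ P_s u_s) (hd : d = u_b - w_a) (hd_pos : 0 < d) :
    P_s ∈ Icc (P_b - h_b / d) (P_a + h_a / d) := by
  -- the coexistence pressure is strictly inside: at `P_a` / `P_b` the difference is not zero
  have hlt_a : P_a < P_s := lt_of_le_of_ne has fun h => by
    subst h
    have e := deltaH_eq_of_isMinOn h1a h1s h2a h2s hu_a hu_s hw_a hw_s
    rw [hzero, sub_self] at e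
    linarith
  have hlt_b : P_s < P_b := lt_of_le_of_ne hsb fun h => by
    subst h
    have e := deltaH_eq_of_isMinOn h1s h1b h2s h2b hu_s hu_b hw_s hw_b
    rw [hzero, sub_self] at e
    linarith
  have hu : u_b ≤ u_s := volume_le_of_lt h1s h1b hu_s hu_b hlt_b
  have hw : w_s ≤ w_a := volume_le_of_lt h2a h2s hw_a hw_s hlt_a
  -- upper sandwiches on (P_a, P_s) and (P_s, P_b)
  obtain ⟨-, upA⟩ := deltaH_sub_mem_Icc h1a h1s h2a h2s hu_a hu_s hw_a hw_s
  obtain ⟨-, upB⟩ := deltaH_sub_mem_Icc h1s h1b h2s h2b hu_s hu_b hw_s hw_b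
  rw [hzero, sub_self] at upA upB
  have eA : (P_s - P_a) * (w_a - u_s) = -((P_s - P_a) * (u_s - w_a)) := by ring
  have eB : (P_b - P_s) * (w_s - u_b) = -((P_b - P_s) * (u_b - w_s)) := by ring
  have hA : (P_s - P_a) * (u_s - w_a) ≤ h_a := by rw [hha]; linarith
  have hB : (P_b - P_s) * (u_b - w_s) ≤ h_b := by rw [hhb]; linarith
  have hda : d ≤ u_s - w_a := by rw [hd]; linarith
  have hdb : d ≤ u_b - w_s := by rw [hd]; linarith
  have h1 := le_div_of_mul_le_of_le hd_pos (sub_nonneg.mpr has) hA hda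
  have h2 := le_div_of_mul_le_of_le hd_pos (sub_nonneg.mpr hsb) hB hdb
  constructor <;> linarith

end Summit.Ventures.CertifiedManyBodySolver.Downfold.StructFlag
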